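import Literature.RingTheory.TightClosure.RegularTightlyClosed
import Literature.AlgebraicGeometry.Resolution.RegularLocalRingsQuotient
import Mathlib.RingTheory.Derivation.Basic
import Mathlib.RingTheory.Localization.AtPrime.Basic
import Mathlib.Algebra.CharP.Algebra
import HarnessLib

/-!
# Smooth points of a hypersurface via a derivation (crux `FrobeniusLadder.FRationalResolution`, line `Sketch`)

Stub `stub_clause_of_derivation` (worker W5) of the skeleton `Sketch` for crux
stmt-ResolutionOfSingularities-15317 (suspension calibration: the local rings of `yz + f = 0` at the
primes not containing `y`, or not containing `z`, are regular). Let `S` be a domain of prime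
characteristic `p`, `P` a prime of `S` with `S_P` a regular local ring, `g ∈ P`, and `D` a
derivation of `S` (over some base ring `R`) with `D g ∉ P`.

* `derivation_apply_mem_of_mem_sq` — a derivation maps `P²` into `P` (`D (a b) = a D b + b D a`).
* `algebraMap_notMem_maximalIdeal_sq` — `g ∉ (P S_P)²`: if `m g ∈ P²` with `m ∉ P` then
  `D (m g) = m · D g + g · D m ∈ P` forces `m · D g ∈ P`, contradicting `m, D g ∉ P`.
* `stub_clause_of_derivation` — hence `S_P/(g)` is a regular local ring (Matsumura 14.2,
  `IsRegularLocalRing.quotient_span_singleton`, in tree), so a domain (Matsumura 14.3,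
  `isDomain_of_isRegularLocalRing`) of characteristic `p` in which every ideal is tightly closed
  (Hochster–Huneke, `isTightlyClosed_of_isRegularLocalRing` + `isTightlyClosed_iff_of_isDomain`, in
  tree) — the crux's stalk clause in its weakly-F-regular inline form.
-/

-- single-problem summit: the doubled namespace component is forced
set_option linter.dupNamespace false

namespace Summit.ResolutionOfSingularities.ResolutionOfSingularities.Theorems.FRationalResolution

open IsLocalRing Literature.RingTheory.TightClosure Literature.AlgebraicGeometry.Resolution

/-- A derivation maps the square of an ideal into the ideal: `a ∈ P² ⇒ D a ∈ P`, from the Leibniz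
rule `D (m n) = m · D n + n · D m` on the generators `m n` (`m, n ∈ P`) and additivity. -/
theorem derivation_apply_mem_of_mem_sq {R S : Type} [CommRing R] [CommRing S] [Algebra R S]
    (D : Derivation R S S) (P : Ideal S) {a : S} (ha : a ∈ P ^ 2) : D a ∈ P := by
  rw [pow_two] at ha
  refine Submodule.mul_induction_on ha (fun m hm n hn => ?_) (fun x y hx hy => ?_)
  · rw [Derivation.leibniz, smul_eq_mul, smul_eq_mul]
    exact add_mem (P.mul_mem_right _ hm) (P.mul_mem_right _ hn)
  · rw [map_add]
    exact add_mem hx hy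

/-- JACOBIAN CRITERION, ONE ELEMENT: if `g ∈ P` (`P` prime) and `D g ∉ P` for some derivation `D`,
then the image of `g` in `S_P` is not in the square of the maximal ideal `P S_P`. Indeed
`(P S_P)² = P² S_P`, so otherwise `m g ∈ P²` for some `m ∉ P`; then
`D (m g) = m · D g + g · D m ∈ P` and `g ∈ P` give `m · D g ∈ P`, impossible. -/
theorem algebraMap_notMem_maximalIdeal_sq {R S : Type} [CommRing R] [CommRing S] [Algebra R S]
    (P : Ideal S) [P.IsPrime] (D : Derivation R S S) {g : S} (hg : g ∈ P) (hD : D g ∉ P) :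
    algebraMap S (Localization.AtPrime P) g ∉ (maximalIdeal (Localization.AtPrime P)) ^ 2 := by
  intro h
  rw [← Localization.AtPrime.map_eq_maximalIdeal, ← Ideal.map_pow,
    IsLocalization.algebraMap_mem_map_algebraMap_iff P.primeCompl] at h
  obtain ⟨m, hm, hmg⟩ := h
  have h1 : D (m * g) ∈ P := derivation_apply_mem_of_mem_sq D P hmg
  rw [Derivation.leibniz, smul_eq_mul, smul_eq_mul] at h1
  have h2 : m * D g ∈ P := (Submodule.add_mem_iff_left P (P.mul_mem_right _ hg)).mp h1
  rcases ‹P.IsPrime›.mem_or_mem h2 with h3 | h3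
  · exact Ideal.mem_primeCompl_iff.mp hm h3
  · exact hD h3

/-- SMOOTH POINTS OF A HYPERSURFACE VIA A DERIVATION. `S` a domain of characteristic `p` with `S_P`
regular local, `g ∈ P`, and a derivation `D` with `D g ∉ P`. Then `g ∉ (P S_P)²`
(`algebraMap_notMem_maximalIdeal_sq`), so `S_P/(g)` is a regular local ring
(`IsRegularLocalRing.quotient_span_singleton`), hence a domain (`isDomain_of_isRegularLocalRing`) of
characteristic `p` in which every ideal is tightly closed (`isTightlyClosed_of_isRegularLocalRing` +
`isTightlyClosed_iff_of_isDomain`) — the crux's clause in its weakly-F-regular inline form. -/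
theorem stub_clause_of_derivation (p : ℕ) [Fact p.Prime] (R S : Type) [CommRing R] [CommRing S]
    [Algebra R S] [IsDomain S] [CharP S p] (P : Ideal S) [P.IsPrime]
    [IsRegularLocalRing (Localization.AtPrime P)] (D : Derivation R S S) (g : S) (hg : g ∈ P)
    (hD : D g ∉ P) :
    IsDomain (Localization.AtPrime P ⧸ Ideal.span {algebraMap S (Localization.AtPrime P) g}) ∧
    ∀ (I : Ideal (Localization.AtPrime P ⧸ Ideal.span {algebraMap S (Localization.AtPrime P) g}))
      (y c : Localization.AtPrime P ⧸ Ideal.span {algebraMap S (Localization.AtPrime P) g}),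
      c ≠ 0 →
      (∀ e : ℕ, c * y ^ p ^ e ∈ Ideal.span
        ((fun z : Localization.AtPrime P ⧸ Ideal.span {algebraMap S (Localization.AtPrime P) g} =>
          z ^ p ^ e) '' (I : Set (Localization.AtPrime P ⧸
            Ideal.span {algebraMap S (Localization.AtPrime P) g})))) →
      y ∈ I := by
  -- (1) `g ∈ 𝔪 = P S_P`
  have h1 : algebraMap S (Localization.AtPrime P) g ∈ maximalIdeal (Localization.AtPrime P) :=
    (IsLocalization.AtPrime.to_map_mem_maximal_iff (Localization.AtPrime P) P g).mpr hg
  -- (2) `g ∉ 𝔪²` (the derivation)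
  have h2 := algebraMap_notMem_maximalIdeal_sq P D hg hD
  -- (3) `S_P/(g)` is regular local (Matsumura 14.2), hence a domain (Matsumura 14.3)
  haveI hreg := (IsRegularLocalRing.quotient_span_singleton h1 h2).1
  haveI hdom :
      IsDomain (Localization.AtPrime P ⧸ Ideal.span {algebraMap S (Localization.AtPrime P) g}) :=
    isDomain_of_isRegularLocalRing _
  -- (4) characteristic `p` descends along `S → S_P → S_P/(g)` (`S` a domain, the target non-trivial)
  haveI : CharP (Localization.AtPrime P ⧸ Ideal.span {algebraMap S (Localization.AtPrime P) g}) p :=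
    CharP.of_ringHom_of_ne_zero
      ((Ideal.Quotient.mk _).comp (algebraMap S (Localization.AtPrime P))) p
      (Fact.out : p.Prime).ne_zero
  -- (5) every ideal of a regular local ring of characteristic `p` is tightly closed (Hochster–Huneke)
  exact ⟨hdom, fun I => (isTightlyClosed_iff_of_isDomain p).mp
    (isTightlyClosed_of_isRegularLocalRing p I)⟩

end Summit.ResolutionOfSingularities.ResolutionOfSingularities.Theorems.FRationalResolution
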